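import Mathlib
import HarnessLib
import Literature.MathematicalPhysics.QuantumFieldTheory.ConstructiveQFTWave0
import Literature.Analysis.FunctionSpaces.BMOCarlesonConverse
import Literature.Analysis.FunctionSpaces.TorusFourierCalculus
import Summits.Ventures.LatticeQCDFlow.Exactness.CompactHaar

/-!
# LatticeQCDFlow / Scaling — convolution powers of a symmetric weight on a compact group: the odd powers peak at the identity, and the even-step ratios decrease (Cauchy–Schwarz only)

HONEST FRAMING: exact (Metropolis-corrected) sampling algorithms for lattice gauge theory; figures of merit are
autocorrelation/cost numbers at stated couplings and volumes; no continuum-physics claim.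

Venture `LatticeQCDFlow` (cell pub-lqcd), topic `Scaling`, FANOUT row 30 (lean-1) — OUR WORK, the analytic half of
the EXPLICIT `U(1)` tunnelling law in `d = 2` (companion of `Scaling/PlaquetteIndependence2D.lean`).  After the
puncture trick, the Wilson measure of `(ℤ/L)²` differs from a product of one-plaquette laws by ONE factor
`w(∏_x U_x)`, and comparing the two needs, for the Haar-convolution operator

  `(K φ)(u) = ∫ φ(u·g) w(g) dHaar(g)`   (`haarConv w φ`),

a bound on `sup K^{m} w / (K^{n} w)(1)` UNIFORM in `m ≤ n` — a local-limit-type statement.  This file proves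
the two inequalities that give it with NO harmonic analysis (no Bessel functions, no characters), for every
compact second-countable group `G` and every measurable SYMMETRIC weight `w(g⁻¹) = w(g)`:

* `lintegral_haarConv_mul` — `K` is SELF-ADJOINT: `∫ (Kφ)·ψ = ∫ φ·(Kψ)` (right and inversion invariance of
  Haar measure, `Exactness/CompactHaar.lean`); `haarConv_comp_mul_left` — `K` commutes with left
  translations; `haarConv_eq_lintegral_mul_inv` — `(Kχ)(u) = ∫ χ(v) w(u⁻¹v) dv`;
* **`iterate_odd_apply_le`** — ODD POWERS PEAK AT THE IDENTITY: `(K^{2i+1} w)(u) ≤ (K^{2i+1} w)(1)` for all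
  `u` (write it as `⟨Kⁱw, Kⁱw(u⁻¹·)⟩` and use Cauchy–Schwarz + left invariance);
* **`iterate_sq_le`** — LOG-CONVEXITY AT EVEN STEPS: with `a_k := (K^{k+1} w)(1) = ⟨Kᵏw, w⟩`,
  `a_{2j+2}² ≤ a_{2j}·a_{2j+4}` (`a_{2j} = ‖Kʲw‖²`, Cauchy–Schwarz); hence, for `0 < w ≤ 1`,
  **`iterate_ratio_le`**: `a_{2l}·a_2 ≤ a_0·a_{2l+2}` and **`iterate_ratio_pow_le`**:
  `a_{2i}·a_2^{l−i} ≤ a_0^{l−i}·a_{2l}` (`i ≤ l`) — the ratio of far-apart even moments is controlled by the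
  FIRST ratio `a_0/a_2 = ∫w² / ‖Kw‖²`, a one- and three-fold integral;
* `iterate_apply_le_pow` — the trivial growth bound `(Kᵏφ) ≤ M·z^k`, `z = ∫ w`, for `φ ≤ M`.

Everything in `ℝ≥0∞` (lower Lebesgue integrals; Cauchy–Schwarz = the tree's `BMOInv.lintegral_mul_le_rpow_half_mul_rpow_half`,
`ENNReal.rpow_half_sq`).  Elementary; nothing is cited as a fact; one `def` (`haarConv`).
-/

noncomputable section

namespace Summit.Ventures.LatticeQCDFlow.Theory2.HaarConv

open MeasureTheory Literature.MathematicalPhysics.QuantumFieldTheory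
open scoped ENNReal

variable {G : Type*} [Group G] [TopologicalSpace G] [IsTopologicalGroup G] [CompactSpace G]
  [SecondCountableTopology G] [MeasurableSpace G] [BorelSpace G]

/-- **Haar convolution with a weight**: `(K_w φ)(u) = ∫ φ(u·g)·w(g) dHaar(g)` (normalised Haar
probability of the compact group `G`). [folklore] -/
def haarConv (w φ : G → ℝ≥0∞) : G → ℝ≥0∞ := fun u => ∫⁻ g, φ (u * g) * w g ∂(haarProbability G)

/-! ## §1. Measurability, growth, translations -/

/-- `K_w φ` is measurable for measurable `w`, `φ`. [folklore] -/
theorem measurable_haarConv {w φ : G → ℝ≥0∞} (hw : Measurable w) (hφ : Measurable φ) :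
    Measurable (haarConv w φ) := by
  have h : Measurable fun p : G × G => φ (p.1 * p.2) * w p.2 :=
    (hφ.comp measurable_mul).mul (hw.comp measurable_snd)
  exact h.lintegral_prod_right'

/-- All powers `K_wᵏ φ` are measurable. [folklore] -/
theorem measurable_iterate {w φ : G → ℝ≥0∞} (hw : Measurable w) (hφ : Measurable φ) (k : ℕ) :
    Measurable ((haarConv w)^[k] φ) := by
  induction k with
  | zero => simpa using hφ
  | succ k ih => rw [Function.iterate_succ_apply']; exact measurable_haarConv hw ih

omit [SecondCountableTopology G] in
/-- Growth: `φ ≤ M` pointwise ⇒ `K_w φ ≤ M·∫w`. [folklore] -/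
theorem haarConv_apply_le {w φ : G → ℝ≥0∞} (hw : Measurable w) {M : ℝ≥0∞} (hφ : ∀ v, φ v ≤ M)
    (u : G) : haarConv w φ u ≤ M * ∫⁻ g, w g ∂(haarProbability G) := by
  unfold haarConv
  rw [← lintegral_const_mul _ hw]
  exact lintegral_mono fun g => mul_le_mul' (hφ _) le_rfl

omit [SecondCountableTopology G] in
/-- Growth of the powers: `φ ≤ M` ⇒ `K_wᵏ φ ≤ M·(∫w)ᵏ`. [folklore] -/
theorem iterate_apply_le_pow {w φ : G → ℝ≥0∞} (hw : Measurable w) {M : ℝ≥0∞} (hφ : ∀ v, φ v ≤ M)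
    (k : ℕ) (u : G) : (haarConv w)^[k] φ u ≤ M * (∫⁻ g, w g ∂(haarProbability G)) ^ k := by
  induction k generalizing u with
  | zero => simpa using hφ u
  | succ k ih =>
    rw [Function.iterate_succ_apply', pow_succ, ← mul_assoc]
    exact haarConv_apply_le hw ih u

omit [SecondCountableTopology G] in
/-- `K_w` commutes with left translations: `K_w (φ(v·)) = (K_w φ)(v·)`. [folklore] -/
theorem haarConv_comp_mul_left (w φ : G → ℝ≥0∞) (v : G) :
    haarConv w (fun x => φ (v * x)) = fun u => haarConv w φ (v * u) := by
  funext u; simp only [haarConv, mul_assoc]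

omit [SecondCountableTopology G] in
/-- The powers commute with left translations. [folklore] -/
theorem iterate_comp_mul_left (w φ : G → ℝ≥0∞) (v : G) (k : ℕ) :
    (haarConv w)^[k] (fun x => φ (v * x)) = fun u => (haarConv w)^[k] φ (v * u) := by
  induction k with
  | zero => rfl
  | succ k ih => rw [Function.iterate_succ_apply', Function.iterate_succ_apply', ih, haarConv_comp_mul_left]

omit [SecondCountableTopology G] in
/-- `(K_w χ)(u) = ∫ χ(v) w(u⁻¹ v) dv` (left invariance). [folklore] -/
theorem haarConv_eq_lintegral_mul_inv (w χ : G → ℝ≥0∞) (u : G) :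
    haarConv w χ u = ∫⁻ v, χ v * w (u⁻¹ * v) ∂(haarProbability G) := by
  unfold haarConv
  rw [← lintegral_mul_left_eq_self (fun v => χ v * w (u⁻¹ * v)) u]
  simp only [← mul_assoc, inv_mul_cancel, one_mul]

/-! ## §2. Self-adjointness -/

/-- **`K_w` is self-adjoint** for a symmetric weight: `∫ (K_w φ)·ψ dHaar = ∫ φ·(K_w ψ) dHaar`
(Tonelli; right invariance `u ↦ u g⁻¹`; inversion invariance and `w(g⁻¹) = w(g)`). [folklore] -/
theorem lintegral_haarConv_mul {w φ ψ : G → ℝ≥0∞} (hw : Measurable w) (hws : ∀ g, w g⁻¹ = w g)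
    (hφ : Measurable φ) (hψ : Measurable ψ) :
    ∫⁻ u, haarConv w φ u * ψ u ∂(haarProbability G) =
      ∫⁻ u, φ u * haarConv w ψ u ∂(haarProbability G) := by
  unfold haarConv
  have hm1' : ∀ u, Measurable fun g => φ (u * g) * w g := fun u =>
    (hφ.comp (measurable_const_mul u)).mul hw
  have hm2' : ∀ u, Measurable fun g => ψ (u * g) * w g := fun u =>
    (hψ.comp (measurable_const_mul u)).mul hw
  have h1 : ∀ u, (∫⁻ g, φ (u * g) * w g ∂(haarProbability G)) * ψ u =
      ∫⁻ g, φ (u * g) * w g * ψ u ∂(haarProbability G) := fun u =>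
    (lintegral_mul_const (ψ u) (hm1' u)).symm
  have h2 : ∀ u, φ u * ∫⁻ g, ψ (u * g) * w g ∂(haarProbability G) =
      ∫⁻ g, φ u * (ψ (u * g) * w g) ∂(haarProbability G) := fun u =>
    (lintegral_const_mul (φ u) (hm2' u)).symm
  simp_rw [h1, h2]
  have hm1 : AEMeasurable (Function.uncurry fun u g => φ (u * g) * w g * ψ u)
      ((haarProbability G).prod (haarProbability G)) :=
    (((hφ.comp measurable_mul).mul (hw.comp measurable_snd)).mul (hψ.comp measurable_fst)).aemeasurable
  have hm2 : AEMeasurable (Function.uncurry fun u g => φ u * (ψ (u * g) * w g))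
      ((haarProbability G).prod (haarProbability G)) :=
    ((hφ.comp measurable_fst).mul ((hψ.comp measurable_mul).mul (hw.comp measurable_snd))).aemeasurable
  rw [lintegral_lintegral_swap hm1, lintegral_lintegral_swap hm2]
  refine Eq.trans (lintegral_congr fun g => ?_) (lintegral_inv_eq_self (μ := haarProbability G)
    (fun g => ∫⁻ u, φ u * (ψ (u * g) * w g) ∂(haarProbability G)))
  show _ = ∫⁻ u, φ u * (ψ (u * g⁻¹) * w g⁻¹) ∂(haarProbability G)
  rw [hws, ← lintegral_mul_right_eq_self (fun u => φ u * (ψ (u * g⁻¹) * w g)) g]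
  refine lintegral_congr fun u => ?_
  simp only [mul_inv_cancel_right]
  ring

/-- Iterated self-adjointness: `∫ (K_wᵏ φ)·ψ = ∫ φ·(K_wᵏ ψ)`. [folklore] -/
theorem lintegral_iterate_mul {w φ ψ : G → ℝ≥0∞} (hw : Measurable w) (hws : ∀ g, w g⁻¹ = w g)
    (hφ : Measurable φ) (hψ : Measurable ψ) (k : ℕ) :
    ∫⁻ u, (haarConv w)^[k] φ u * ψ u ∂(haarProbability G) =
      ∫⁻ u, φ u * (haarConv w)^[k] ψ u ∂(haarProbability G) := by
  induction k generalizing φ ψ with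
  | zero => rfl
  | succ k ih =>
    rw [Function.iterate_succ_apply, Function.iterate_succ_apply', ih (measurable_haarConv hw hφ) hψ,
      lintegral_haarConv_mul hw hws hφ (measurable_iterate hw hψ k)]

/-! ## §3. Cauchy–Schwarz consequences -/

/-- Cauchy–Schwarz, squared form: `(∫ f g)² ≤ (∫ f²)(∫ g²)` (from the tree's `(·)^{1/2}` form
`Literature…BMOInv.lintegral_mul_le_rpow_half_mul_rpow_half`, Hölder with `p = q = 2`). [folklore] -/
theorem lintegral_mul_sq_le {α : Type*} [MeasurableSpace α] (μ : Measure α) {f g : α → ℝ≥0∞}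
    (hf : AEMeasurable f μ) (hg : AEMeasurable g μ) :
    (∫⁻ a, f a * g a ∂μ) ^ 2 ≤ (∫⁻ a, f a ^ 2 ∂μ) * (∫⁻ a, g a ^ 2 ∂μ) := by
  calc (∫⁻ a, f a * g a ∂μ) ^ 2
      ≤ ((∫⁻ a, f a ^ 2 ∂μ) ^ (1 / 2 : ℝ) * (∫⁻ a, g a ^ 2 ∂μ) ^ (1 / 2 : ℝ)) ^ 2 := by
        gcongr; exact Literature.Analysis.FunctionSpaces.BMOInv.lintegral_mul_le_rpow_half_mul_rpow_half μ hf hg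
    _ = _ := by rw [mul_pow, ENNReal.rpow_half_sq, ENNReal.rpow_half_sq]

omit [SecondCountableTopology G] in
/-- `(K_wᵏ⁺¹ w)(1) = ∫ (K_wᵏ w)·w`: the values at the identity are the moments `a_k = ⟨K_wᵏ w, w⟩`.
[folklore] -/
theorem iterate_succ_apply_one (w : G → ℝ≥0∞) (k : ℕ) :
    (haarConv w)^[k + 1] w 1 = ∫⁻ v, (haarConv w)^[k] w v * w v ∂(haarProbability G) := by
  rw [Function.iterate_succ_apply']
  simp only [haarConv, one_mul]

/-- `∫ (K_wᵐ w)² = (K_w^{2m+1} w)(1) = a_{2m}` (self-adjointness). [folklore] -/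
theorem lintegral_iterate_sq {w : G → ℝ≥0∞} (hw : Measurable w) (hws : ∀ g, w g⁻¹ = w g) (m : ℕ) :
    ∫⁻ v, ((haarConv w)^[m] w v) ^ 2 ∂(haarProbability G) = (haarConv w)^[2 * m + 1] w 1 := by
  rw [iterate_succ_apply_one, show 2 * m = m + m by ring, Function.iterate_add_apply,
    lintegral_iterate_mul hw hws (measurable_iterate hw hw m) hw m]
  exact lintegral_congr fun v => sq _

/-- **ODD POWERS PEAK AT THE IDENTITY**: `(K_w^{2i+1} w)(u) ≤ (K_w^{2i+1} w)(1)` for every `u` —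
`(K_w^{2i+1} w)(u) = ⟨K_wⁱ w, (K_wⁱ w)(u⁻¹·)⟩ ≤ ‖K_wⁱ w‖² = (K_w^{2i+1} w)(1)` by Cauchy–Schwarz and left
invariance.  (For EVEN powers this needs positive-definiteness of `w`; not claimed.) [folklore] -/
theorem iterate_odd_apply_le {w : G → ℝ≥0∞} (hw : Measurable w) (hws : ∀ g, w g⁻¹ = w g) (i : ℕ)
    (u : G) : (haarConv w)^[2 * i + 1] w u ≤ (haarConv w)^[2 * i + 1] w 1 := by
  have hKi : Measurable ((haarConv w)^[i] w) := measurable_iterate hw hw i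
  rw [← lintegral_iterate_sq hw hws i, Function.iterate_succ_apply', haarConv_eq_lintegral_mul_inv,
    show 2 * i = i + i by ring, Function.iterate_add_apply,
    lintegral_iterate_mul hw hws (φ := (haarConv w)^[i] w) (ψ := fun v => w (u⁻¹ * v)) hKi
      (hw.comp (measurable_const_mul u⁻¹)) i, iterate_comp_mul_left]
  calc ∫⁻ v, (haarConv w)^[i] w v * (haarConv w)^[i] w (u⁻¹ * v) ∂(haarProbability G)
      ≤ (∫⁻ v, ((haarConv w)^[i] w v) ^ 2 ∂(haarProbability G)) ^ (1 / 2 : ℝ) *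
          (∫⁻ v, ((haarConv w)^[i] w (u⁻¹ * v)) ^ 2 ∂(haarProbability G)) ^ (1 / 2 : ℝ) :=
        Literature.Analysis.FunctionSpaces.BMOInv.lintegral_mul_le_rpow_half_mul_rpow_half _
          hKi.aemeasurable (hKi.comp (measurable_const_mul u⁻¹)).aemeasurable
    _ = ∫⁻ v, ((haarConv w)^[i] w v) ^ 2 ∂(haarProbability G) := by
        rw [lintegral_mul_left_eq_self (fun v => ((haarConv w)^[i] w v) ^ 2) u⁻¹, ← sq,
          ENNReal.rpow_half_sq]

/-- **LOG-CONVEXITY AT EVEN STEPS**: `a_{2j+2}² ≤ a_{2j}·a_{2j+4}`, i.e.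
`((K_w^{2j+3} w)(1))² ≤ (K_w^{2j+1} w)(1)·(K_w^{2j+5} w)(1)` — `a_{2j+2} = ⟨K_w^{j+2} w, K_wʲ w⟩` and
Cauchy–Schwarz. [folklore] -/
theorem iterate_sq_le {w : G → ℝ≥0∞} (hw : Measurable w) (hws : ∀ g, w g⁻¹ = w g) (j : ℕ) :
    ((haarConv w)^[2 * j + 3] w 1) ^ 2 ≤
      (haarConv w)^[2 * j + 1] w 1 * (haarConv w)^[2 * (j + 2) + 1] w 1 := by
  have hK : ∀ m, Measurable ((haarConv w)^[m] w) := measurable_iterate hw hw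
  rw [show 2 * j + 3 = (j + (j + 2)) + 1 by ring, iterate_succ_apply_one, Function.iterate_add_apply,
    lintegral_iterate_mul hw hws (φ := (haarConv w)^[j + 2] w) (ψ := w) (hK _) hw j,
    ← lintegral_iterate_sq hw hws j, ← lintegral_iterate_sq hw hws (j + 2), mul_comm]
  exact lintegral_mul_sq_le _ (hK _).aemeasurable (hK _).aemeasurable

/-! ## §4. The ratio bounds (`0 < w ≤ 1`) -/

/-- The powers of a nowhere-vanishing weight vanish nowhere. [folklore] -/
theorem iterate_apply_ne_zero {w : G → ℝ≥0∞} (hw : Measurable w) (hw0 : ∀ g, w g ≠ 0) (k : ℕ)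
    (u : G) : (haarConv w)^[k] w u ≠ 0 := by
  induction k generalizing u with
  | zero => exact hw0 u
  | succ k ih =>
    rw [Function.iterate_succ_apply']
    intro h
    have hm : Measurable fun g => (haarConv w)^[k] w (u * g) * w g :=
      ((measurable_iterate hw hw k).comp (measurable_const_mul u)).mul hw
    have hae := (lintegral_eq_zero_iff hm).mp h
    obtain ⟨g, hg⟩ := hae.exists
    exact mul_ne_zero (ih (u * g)) (hw0 g) hg

omit [SecondCountableTopology G] in
/-- The powers of a weight `≤ 1` are `≤ 1`. [folklore] -/
theorem iterate_apply_le_one {w : G → ℝ≥0∞} (hw : Measurable w) (hw1 : ∀ g, w g ≤ 1) (k : ℕ)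
    (u : G) : (haarConv w)^[k] w u ≤ 1 := by
  refine (iterate_apply_le_pow hw hw1 k u).trans ?_
  rw [one_mul]
  refine pow_le_one₀ zero_le ?_
  calc ∫⁻ g, w g ∂(haarProbability G) ≤ ∫⁻ _, 1 ∂(haarProbability G) := lintegral_mono fun g => hw1 g
    _ = 1 := by rw [lintegral_one, measure_univ]

/-- **THE EVEN-STEP RATIOS DECREASE**: `a_{2l}·a_2 ≤ a_0·a_{2l+2}`, i.e.
`(K_w^{2l+1} w)(1)·(K_w³ w)(1) ≤ (K_w w)(1)·(K_w^{2l+3} w)(1)` — by induction from `iterate_sq_le`,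
cancelling the (finite, non-zero) middle moment. [folklore] -/
theorem iterate_ratio_le {w : G → ℝ≥0∞} (hw : Measurable w) (hws : ∀ g, w g⁻¹ = w g)
    (hw0 : ∀ g, w g ≠ 0) (hw1 : ∀ g, w g ≤ 1) (l : ℕ) :
    (haarConv w)^[2 * l + 1] w 1 * (haarConv w)^[3] w 1 ≤
      (haarConv w)^[1] w 1 * (haarConv w)^[2 * (l + 1) + 1] w 1 := by
  induction l with
  | zero => rw [mul_comm]
  | succ l ih =>
    have hsq := iterate_sq_le hw hws l
    have hne0 : (haarConv w)^[2 * l + 3] w 1 ≠ 0 := iterate_apply_ne_zero hw hw0 _ _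
    have hnet : (haarConv w)^[2 * l + 3] w 1 ≠ ⊤ :=
      ne_top_of_le_ne_top ENNReal.one_ne_top (iterate_apply_le_one hw hw1 _ _)
    rw [show 2 * (l + 1) + 1 = 2 * l + 3 by ring] at ih ⊢
    rw [show 2 * (l + 1 + 1) + 1 = 2 * (l + 2) + 1 by ring]
    rw [← ENNReal.mul_le_mul_iff_right hne0 hnet]
    calc (haarConv w)^[2 * l + 3] w 1 * ((haarConv w)^[2 * l + 3] w 1 * (haarConv w)^[3] w 1)
        = ((haarConv w)^[2 * l + 3] w 1) ^ 2 * (haarConv w)^[3] w 1 := by ring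
      _ ≤ ((haarConv w)^[2 * l + 1] w 1 * (haarConv w)^[2 * (l + 2) + 1] w 1) *
            (haarConv w)^[3] w 1 := by gcongr
      _ = ((haarConv w)^[2 * l + 1] w 1 * (haarConv w)^[3] w 1) *
            (haarConv w)^[2 * (l + 2) + 1] w 1 := by ring
      _ ≤ ((haarConv w)^[1] w 1 * (haarConv w)^[2 * l + 3] w 1) *
            (haarConv w)^[2 * (l + 2) + 1] w 1 := by gcongr
      _ = _ := by ring

/-- **RATIO OF FAR-APART EVEN MOMENTS**: `a_{2i}·a_2ⁿ ≤ a_0ⁿ·a_{2(i+n)}`, i.e.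
`(K_w^{2i+1} w)(1)·((K_w³ w)(1))ⁿ ≤ ((K_w w)(1))ⁿ·(K_w^{2(i+n)+1} w)(1)`: the first ratio
`a_0/a_2 = ∫w² / ∫(K_w w)²` controls all of them. [folklore] -/
theorem iterate_ratio_pow_le {w : G → ℝ≥0∞} (hw : Measurable w) (hws : ∀ g, w g⁻¹ = w g)
    (hw0 : ∀ g, w g ≠ 0) (hw1 : ∀ g, w g ≤ 1) (i n : ℕ) :
    (haarConv w)^[2 * i + 1] w 1 * ((haarConv w)^[3] w 1) ^ n ≤
      ((haarConv w)^[1] w 1) ^ n * (haarConv w)^[2 * (i + n) + 1] w 1 := by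
  induction n with
  | zero => simp
  | succ n ih =>
    calc (haarConv w)^[2 * i + 1] w 1 * ((haarConv w)^[3] w 1) ^ (n + 1)
        = ((haarConv w)^[2 * i + 1] w 1 * ((haarConv w)^[3] w 1) ^ n) * (haarConv w)^[3] w 1 := by
          ring
      _ ≤ (((haarConv w)^[1] w 1) ^ n * (haarConv w)^[2 * (i + n) + 1] w 1) *
            (haarConv w)^[3] w 1 := by gcongr
      _ = ((haarConv w)^[1] w 1) ^ n *
            ((haarConv w)^[2 * (i + n) + 1] w 1 * (haarConv w)^[3] w 1) := by ring
      _ ≤ ((haarConv w)^[1] w 1) ^ n *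
            ((haarConv w)^[1] w 1 * (haarConv w)^[2 * (i + n + 1) + 1] w 1) := by
          gcongr ?_ * ?_
          · exact le_rfl
          · exact iterate_ratio_le hw hws hw0 hw1 (i + n)
      _ = _ := by rw [show i + (n + 1) = i + n + 1 from (Nat.add_assoc _ _ _).symm]; ring

/-- **SUP OF A HIGH POWER AGAINST AN ODD MOMENT**: `(K_w^{k+2i+1} w)(u) ≤ (K_w^{2i+1} w)(1)·(∫w)ᵏ` for
every `u`. [folklore] -/
theorem iterate_apply_le_pow_mul {w : G → ℝ≥0∞} (hw : Measurable w) (hws : ∀ g, w g⁻¹ = w g)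
    (i k : ℕ) (u : G) :
    (haarConv w)^[k + (2 * i + 1)] w u ≤
      (haarConv w)^[2 * i + 1] w 1 * (∫⁻ g, w g ∂(haarProbability G)) ^ k := by
  rw [Function.iterate_add_apply]
  exact iterate_apply_le_pow hw (fun v => iterate_odd_apply_le hw hws i v) k u

end Summit.Ventures.LatticeQCDFlow.Theory2.HaarConv
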